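import Summits.PneNP.PneNP.Theorems.NegLimitedGapPMParametric
import Summits.PneNP.PneNP.Theorems.NegLimitedGapPMQuasipolyOfExp
import Literature.Computability.Complexity.RobustSunflowerBoundProofs

/-!
# Route NegLimited — T5⁺ `GapPerfectMatchingExp`: the parameter discharge (rung F-N1/p3, line r7-crosscut)

From the parametric dichotomy `gapPM_dichotomy` (`NegLimitedGapPMParametric.lean`) to T5⁺
`GapPerfectMatchingExp` (`gapPMExp_of`; the registered stub `stub_gapPMExp` of the skeleton line
`r7-crosscut`, item stmt-PneNP-19861, is the one-liner of `NegLimitedGapPMExpStub.lean` on top of it;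
cell record HOME/pnp-ideate-p3/ROUND-7.md §4 "DISCHARGE"). Parameters, for a gap `K ≥ 2` and `δ > 0` (wlog
`δ ≤ 1/6`): `w = ⌊m^{1/3-δ/2}⌋`, closedness `c = 2w` (trim at `w`), `ε = m^{-5w}`, bias `p = 1/8`.
Then `δN = ε·#{A : |A| ≤ 2w} ≤ (2w+1) m^{-w} ≤ 2^{-(w+1)}`, every positive term
`thr(ℓ)(m-ℓ)!/m! ≤ q^ℓ` with `q = 9216 c₀ w³ log²m / m ≤ 1/4` eventually (`w³ ≤ m^{1-3δ/2}`,
`log² m = o(m^{3δ/2})`), so `S ≤ 1/3`, `δP ≤ 4^{-w}/3`, and either branch of the dichotomy gives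
`size ≥ 2^w ≥ 2^{m^{1/3-δ}}`.
-/

set_option linter.dupNamespace false -- `Summit.PneNP.PneNP.…`: summit = sub-problem name (D-0017 single-conjunct layout)

namespace Summit.PneNP.PneNP.Theorems.NegLimitedGapPM

open Finset Filter Literature.Computability.Complexity Literature.Computability.Complexity.PerfectMatching
  Literature.Computability.Complexity.CKR
open Literature.Barriers.PneNP (perfectMatchingFn)

/-! ### Elementary estimates -/

/-- `(m-ℓ)!/m! ≤ (2/m)^ℓ` for `2ℓ ≤ m + 2` (each of the `ℓ` factors `m, m-1, …, m-ℓ+1` is `≥ m/2`). -/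
theorem factorial_div_factorial_le {m ℓ : ℕ} (hℓm : ℓ ≤ m) (h2 : 2 * ℓ ≤ m + 2) (hm : 1 ≤ m) :
    (((m - ℓ).factorial : ℝ) / m.factorial) ≤ (2 / (m : ℝ)) ^ ℓ := by
  have hmf : (0 : ℝ) < m.factorial := by exact_mod_cast Nat.factorial_pos m
  have hmr : (0 : ℝ) < m := by exact_mod_cast hm
  have hdesc : ((m - ℓ).factorial : ℝ) * m.descFactorial ℓ = m.factorial := by
    exact_mod_cast Nat.factorial_mul_descFactorial hℓm
  have hpow : ((m + 1 - ℓ : ℕ) : ℝ) ^ ℓ ≤ m.descFactorial ℓ := by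
    exact_mod_cast Nat.pow_sub_le_descFactorial m ℓ
  have h2r : (2 : ℝ) * ℓ ≤ m + 2 := by exact_mod_cast h2
  have hhalf : (m : ℝ) / 2 ≤ ((m + 1 - ℓ : ℕ) : ℝ) := by
    rw [Nat.cast_sub (by omega)]; push_cast; linarith
  have hdpos : (0 : ℝ) < ((m : ℝ) / 2) ^ ℓ := by positivity
  have hdesc_ge : ((m : ℝ) / 2) ^ ℓ ≤ m.descFactorial ℓ :=
    (pow_le_pow_left₀ (by positivity) hhalf ℓ).trans hpow
  rw [div_le_iff₀ hmf, ← hdesc]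
  have : (1 : ℝ) ≤ (2 / (m : ℝ)) ^ ℓ * m.descFactorial ℓ := by
    calc (1 : ℝ) = (2 / (m : ℝ)) ^ ℓ * ((m : ℝ) / 2) ^ ℓ := by
          rw [← mul_pow, show (2 : ℝ) / m * (m / 2) = 1 by field_simp, one_pow]
      _ ≤ (2 / (m : ℝ)) ^ ℓ * m.descFactorial ℓ :=
          mul_le_mul_of_nonneg_left hdesc_ge (by positivity)
  have hf0 : (0 : ℝ) ≤ ((m - ℓ).factorial : ℝ) := by positivity
  nlinarith

/-- The sunflower threshold at `p = 1/8`, `ε = m^{-5w}`: `thr(ℓ) ≤ (4608 c₀ w³ log²m)^ℓ` for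
`1 ≤ ℓ ≤ 2w`, `1 ≤ w`, `2w ≤ m` (`log(ℓ/ε) = log ℓ + 5w log m ≤ 6 w log m`). -/
theorem thr_le {c₀ : ℝ} (hc0 : 0 ≤ c₀) {m w ℓ : ℕ} (hw : 1 ≤ w) (hwm : 2 * w ≤ m) (hℓ1 : 1 ≤ ℓ)
    (hℓw : ℓ ≤ 2 * w) :
    thr c₀ (1 / 8) (1 / (m : ℝ) ^ (5 * w)) ℓ ≤ (4608 * c₀ * (w : ℝ) ^ 3 * Real.log m ^ 2) ^ ℓ := by
  have hm2 : (2 : ℝ) ≤ m := by exact_mod_cast (by omega : 2 ≤ m)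
  have hm0 : (0 : ℝ) < m := by linarith
  have hℓr : (1 : ℝ) ≤ ℓ := by exact_mod_cast hℓ1
  have hwr : (1 : ℝ) ≤ w := by exact_mod_cast hw
  have hlogm : 0 ≤ Real.log m := Real.log_nonneg (by linarith)
  have hlog2 : Real.log 2 ≤ Real.log m := Real.log_le_log two_pos hm2
  have hlog2' : (0 : ℝ) < Real.log 2 := Real.log_pos one_lt_two
  -- `log(ℓ/ε) = log ℓ + 5w log m ≤ 6 w log m`
  have hL : Real.log (ℓ / (1 / (m : ℝ) ^ (5 * w))) ≤ 6 * w * Real.log m := by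
    rw [div_div_eq_mul_div, div_one, Real.log_mul (by positivity) (by positivity), Real.log_pow]
    have hℓm : Real.log ℓ ≤ Real.log m :=
      Real.log_le_log (by positivity) (by exact_mod_cast (by omega : ℓ ≤ m))
    have : Real.log m ≤ w * Real.log m := le_mul_of_one_le_left hlogm hwr
    push_cast
    nlinarith
  have hL0 : 0 ≤ Real.log (ℓ / (1 / (m : ℝ) ^ (5 * w))) := by
    apply Real.log_nonneg
    rw [le_div_iff₀ (by positivity)]
    have : (1 : ℝ) / (m : ℝ) ^ (5 * w) ≤ 1 := by
      rw [div_le_one (by positivity)]; exact one_le_pow₀ (by linarith)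
    linarith
  unfold thr
  refine pow_le_pow_left₀ (by positivity) ?_ ℓ
  have hℓ2w : (ℓ : ℝ) ≤ 2 * w := by exact_mod_cast hℓw
  have hsq : Real.log (ℓ / (1 / (m : ℝ) ^ (5 * w))) ^ 2 ≤ (6 * w * Real.log m) ^ 2 :=
    pow_le_pow_left₀ hL0 hL 2
  calc c₀ * ℓ * Real.log (ℓ / (1 / (m : ℝ) ^ (5 * w))) ^ 2 / (1 / 8) ^ 2
      = 64 * (c₀ * ℓ * Real.log (ℓ / (1 / (m : ℝ) ^ (5 * w))) ^ 2) := by norm_num; ring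
    _ ≤ 64 * (c₀ * (2 * w) * (6 * w * Real.log m) ^ 2) := by
        gcongr
    _ = 4608 * c₀ * (w : ℝ) ^ 3 * Real.log m ^ 2 := by ring

/-- The negative gain at `ε = m^{-5w}`, `c = 2w`: `δN ≤ (2w+1) m^{4w} m^{-5w} ≤ 2^{-(w+1)}` for `m ≥ 16`. -/
theorem negGain_le {m w : ℕ} (hw : 1 ≤ w) (hm : 16 ≤ m) :
    negGain (1 / (m : ℝ) ^ (5 * w)) m (2 * w) ≤ 1 / 2 ^ (w + 1) := by
  unfold negGain
  have hm0 : (0 : ℝ) < m := by exact_mod_cast (by omega : 0 < m)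
  have hcardE : Fintype.card (Edge m) = m * m := by simp [Fintype.card_prod]
  have hcnt : (#(univ.filter fun A : Finset (Edge m) => #A ≤ 2 * w) : ℝ) ≤ (2 * w + 1) * ((m : ℝ) * m) ^ (2 * w) := by
    have h := card_filter_card_le_le (α := Edge m) (by rw [hcardE]; positivity) (2 * w)
    rw [hcardE] at h
    exact_mod_cast h
  -- (2w+1) m^{4w} / m^{5w} = (2w+1)/m^w ≤ 2^{-(w+1)}
  have hkeyN : ∀ k, 1 ≤ k → (2 * k + 1) * 2 ^ (k + 1) ≤ m ^ k := by
    intro k hk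
    induction k, hk using Nat.le_induction with
    | base => simp; omega
    | succ k hk ih =>
      calc (2 * (k + 1) + 1) * 2 ^ (k + 1 + 1) = 2 * (2 * k + 3) * 2 ^ (k + 1) := by ring
        _ ≤ 16 * (2 * k + 1) * 2 ^ (k + 1) := Nat.mul_le_mul_right _ (by omega)
        _ = 16 * ((2 * k + 1) * 2 ^ (k + 1)) := by ring
        _ ≤ m * m ^ k := Nat.mul_le_mul hm ih
        _ = m ^ (k + 1) := by ring
  have hkey : ((2 * w + 1 : ℕ) : ℝ) * 2 ^ (w + 1) ≤ (m : ℝ) ^ w := by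
    exact_mod_cast hkeyN w hw
  have hpow : ((m : ℝ) * m) ^ (2 * w) * (m : ℝ) ^ w = (m : ℝ) ^ (5 * w) := by
    rw [mul_pow, ← pow_add, ← pow_add]; congr 1; ring
  have hratio : ((m : ℝ) * m) ^ (2 * w) / (m : ℝ) ^ (5 * w) = 1 / (m : ℝ) ^ w := by
    rw [div_eq_div_iff (by positivity) (by positivity), one_mul, hpow]
  calc 1 / (m : ℝ) ^ (5 * w) * #(univ.filter fun A : Finset (Edge m) => #A ≤ 2 * w)
      ≤ 1 / (m : ℝ) ^ (5 * w) * ((2 * w + 1) * ((m : ℝ) * m) ^ (2 * w)) :=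
        mul_le_mul_of_nonneg_left hcnt (by positivity)
    _ = (2 * w + 1) * (((m : ℝ) * m) ^ (2 * w) / (m : ℝ) ^ (5 * w)) := by ring
    _ = (2 * w + 1) / (m : ℝ) ^ w := by rw [hratio]; ring
    _ ≤ 1 / 2 ^ (w + 1) := by
        rw [div_le_div_iff₀ (by positivity) (by positivity), one_mul]
        exact_mod_cast hkey

/-- Both positive sums are geometric: with `q ≤ 1/4` bounding every term `thr(ℓ)(m-ℓ)!/m! ≤ q^ℓ`
(`1 ≤ ℓ ≤ 2w`), `S ≤ 1/3` and `δP ≤ q^{w+1}·4/3 ≤ (1/3)·4^{-w}`. -/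
theorem posSmall_posLost_le {c₀ : ℝ} (hc0 : 0 ≤ c₀) {m w : ℕ} (hw : 1 ≤ w) (hwm : 4 * w ≤ m)
    (hq : 9216 * c₀ * (w : ℝ) ^ 3 * Real.log m ^ 2 / m ≤ 1 / 4) :
    posSmall c₀ (1 / (m : ℝ) ^ (5 * w)) m (2 * w) ≤ 1 / 3 ∧
      posLost c₀ (1 / (m : ℝ) ^ (5 * w)) m (2 * w) ≤ 1 / 3 * (1 / 4) ^ w := by
  set q : ℝ := 9216 * c₀ * (w : ℝ) ^ 3 * Real.log m ^ 2 / m with hqdef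
  have hm1 : 1 ≤ m := by omega
  have hm0 : (0 : ℝ) < m := by exact_mod_cast (by omega : 0 < m)
  have hq0 : 0 ≤ q := by
    have : 0 ≤ Real.log m ^ 2 := sq_nonneg _
    positivity
  have hterm : ∀ ℓ ∈ Icc 1 (2 * w),
      thr c₀ (1 / 8) (1 / (m : ℝ) ^ (5 * w)) ℓ * (((m - ℓ).factorial : ℝ) / m.factorial) ≤ q ^ ℓ := by
    intro ℓ hℓ
    rw [mem_Icc] at hℓ
    have h1 := thr_le (m := m) hc0 hw (by omega) hℓ.1 hℓ.2
    have h2 := factorial_div_factorial_le (m := m) (ℓ := ℓ) (by omega) (by omega) hm1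
    have hthr0 : 0 ≤ thr c₀ (1 / 8) (1 / (m : ℝ) ^ (5 * w)) ℓ := by
      unfold thr
      have : 0 ≤ Real.log (ℓ / (1 / (m : ℝ) ^ (5 * w))) ^ 2 := sq_nonneg _
      positivity
    calc thr c₀ (1 / 8) (1 / (m : ℝ) ^ (5 * w)) ℓ * (((m - ℓ).factorial : ℝ) / m.factorial)
        ≤ (4608 * c₀ * (w : ℝ) ^ 3 * Real.log m ^ 2) ^ ℓ * (2 / (m : ℝ)) ^ ℓ :=
          mul_le_mul h1 h2 (by positivity) (by positivity)
      _ = q ^ ℓ := by rw [← mul_pow, hqdef]; congr 1; field_simp; ring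
  have hq1 : q < 1 := by linarith
  constructor
  · unfold posSmall
    have hIcc : Icc 1 (2 * w / 2) = Ico 1 (w + 1) := by
      ext ℓ; simp only [mem_Icc, mem_Ico]; omega
    calc ∑ ℓ ∈ Icc 1 (2 * w / 2), thr c₀ (1 / 8) (1 / (m : ℝ) ^ (5 * w)) ℓ *
          (((m - ℓ).factorial : ℝ) / m.factorial)
        ≤ ∑ ℓ ∈ Icc 1 (2 * w / 2), q ^ ℓ :=
          sum_le_sum fun ℓ hℓ => hterm ℓ (by rw [mem_Icc] at hℓ ⊢; omega)
      _ = ∑ ℓ ∈ Ico 1 (w + 1), q ^ ℓ := by rw [hIcc]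
      _ ≤ q ^ 1 / (1 - q) := geom_sum_Ico_le_of_lt_one hq0 hq1
      _ ≤ 1 / 3 := by
          rw [pow_one, div_le_iff₀ (by linarith)]; linarith
  · unfold posLost
    have hIoc : Ioc (2 * w / 2) (2 * w) = Ico (w + 1) (2 * w + 1) := by
      ext ℓ; simp only [mem_Ioc, mem_Ico]; omega
    calc ∑ ℓ ∈ Ioc (2 * w / 2) (2 * w), thr c₀ (1 / 8) (1 / (m : ℝ) ^ (5 * w)) ℓ *
          (((m - ℓ).factorial : ℝ) / m.factorial)
        ≤ ∑ ℓ ∈ Ioc (2 * w / 2) (2 * w), q ^ ℓ :=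
          sum_le_sum fun ℓ hℓ => hterm ℓ (by rw [mem_Ioc] at hℓ; rw [mem_Icc]; omega)
      _ = ∑ ℓ ∈ Ico (w + 1) (2 * w + 1), q ^ ℓ := by rw [hIoc]
      _ ≤ q ^ (w + 1) / (1 - q) := geom_sum_Ico_le_of_lt_one hq0 hq1
      _ ≤ (1 / 4) ^ (w + 1) / (1 - q) :=
          div_le_div_of_nonneg_right (pow_le_pow_left₀ hq0 hq (w + 1)) (by linarith)
      _ ≤ (1 / 4) ^ (w + 1) / (3 / 4) :=
          div_le_div_of_nonneg_left (by positivity) (by norm_num) (by linarith)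
      _ = 1 / 3 * (1 / 4) ^ w := by rw [pow_succ]; ring

/-! ### The discharge -/

/-- **T5⁺ from the inputs of the line**: `SunflowerBound c₀` (the biased Matching Sunflower Lemma with
its constant), `CrossDeficient`, `DeficientMass` ⟹ `GapPerfectMatchingExp`. -/
theorem gapPMExp_of {c₀ : ℝ} (hSF : SunflowerBound c₀) (hc0 : 0 < c₀) (hCD : CrossDeficient)
    (hDM : DeficientMass) : GapPerfectMatchingExp := by
  intro K hK δ hδ
  -- wlog `δ ≤ 1/6`
  set δ₀ : ℝ := min δ (1 / 6) with hδ₀def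
  have hδ₀ : 0 < δ₀ := lt_min hδ (by norm_num)
  have hδ₀6 : δ₀ ≤ 1 / 6 := min_le_right _ _
  have hδ₀δ : δ₀ ≤ δ := min_le_left _ _
  set a : ℝ := 1 / 3 - δ₀ / 2 with hadef
  have ha4 : 1 / 4 ≤ a := by rw [hadef]; linarith
  have ha3 : a ≤ 1 / 3 := by rw [hadef]; linarith
  -- eventual estimates in `m`
  have E4 : ∀ᶠ m : ℕ in atTop, 9216 * c₀ * Real.log m ^ 2 ≤ 1 / 4 * (m : ℝ) ^ (3 * δ₀ / 2) := by
    have hlo := (isLittleO_log_rpow_rpow_atTop (2 : ℝ) (by positivity : (0 : ℝ) < 3 * δ₀ / 2)).bound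
      (show (0 : ℝ) < 1 / 4 / (9216 * c₀) by positivity)
    filter_upwards [tendsto_natCast_atTop_atTop.eventually hlo, eventually_ge_atTop 1] with m hb hm1
    have hm1r : (1 : ℝ) ≤ m := by exact_mod_cast hm1
    rw [Real.norm_of_nonneg (Real.rpow_nonneg (Real.log_nonneg hm1r) _),
      Real.norm_of_nonneg (Real.rpow_nonneg (by linarith) _), Real.rpow_two] at hb
    have hc' : (0 : ℝ) < 9216 * c₀ := by positivity
    calc 9216 * c₀ * Real.log m ^ 2 ≤ 9216 * c₀ * (1 / 4 / (9216 * c₀) * (m : ℝ) ^ (3 * δ₀ / 2)) :=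
          mul_le_mul_of_nonneg_left hb hc'.le
      _ = 1 / 4 * (m : ℝ) ^ (3 * δ₀ / 2) := by field_simp
  have E5 : ∀ᶠ m : ℕ in atTop, (2 : ℝ) ≤ (m : ℝ) ^ (δ₀ / 2) :=
    tendsto_natCast_atTop_atTop.eventually ((tendsto_rpow_atTop (by positivity)).eventually_ge_atTop 2)
  filter_upwards [eventually_ge_atTop 16, E4, E5] with m hm16 hE4 hE5 C hC hacc hrej
  -- the parameters
  have hm1 : 1 ≤ m := by omega
  have hm0 : (0 : ℝ) < m := by exact_mod_cast (by omega : 0 < m)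
  have hm1r : (1 : ℝ) ≤ m := by exact_mod_cast hm1
  have h16r : (16 : ℝ) ≤ m := by exact_mod_cast hm16
  set w : ℕ := ⌊(m : ℝ) ^ a⌋₊ with hwdef
  have hma1 : (1 : ℝ) ≤ (m : ℝ) ^ a := Real.one_le_rpow hm1r (by linarith)
  have hw1 : 1 ≤ w := (Nat.one_le_floor_iff _).2 hma1
  have hwle : (w : ℝ) ≤ (m : ℝ) ^ a := Nat.floor_le (by positivity)
  have hwlt : (m : ℝ) ^ a < w + 1 := Nat.lt_floor_add_one _
  -- `4w ≤ m`: `w ≤ m^{1/3}` and `4 m^{1/3} ≤ m` for `m ≥ 64`; here via `w^3 ≤ m` and `w ≥ ...`; we use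
  -- `w ≤ m^a ≤ m^{1/3}` and `64 ≤ m`? only `16 ≤ m` is available, so argue `(4w)^3 = 64 w^3 ≤ 64 m^{3a}`:
  have hw3 : (w : ℝ) ^ 3 ≤ (m : ℝ) ^ (3 * a) := by
    calc (w : ℝ) ^ 3 ≤ ((m : ℝ) ^ a) ^ 3 := pow_le_pow_left₀ (by positivity) hwle 3
      _ = (m : ℝ) ^ (3 * a) := by
          rw [← Real.rpow_natCast, ← Real.rpow_mul hm0.le]; norm_num; ring_nf
  have h4w : 4 * w ≤ m := by
    -- `w ≤ m^{1/3}` and `m^{1/3} · 4 ≤ m^{1/3} · m^{2/3}` as `m^{2/3} ≥ 16^{2/3} ≥ 4`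
    have h13 : (w : ℝ) ≤ (m : ℝ) ^ (1 / 3 : ℝ) :=
      hwle.trans (Real.rpow_le_rpow_of_exponent_le hm1r ha3)
    have h23 : (4 : ℝ) ≤ (m : ℝ) ^ (2 / 3 : ℝ) := by
      calc (4 : ℝ) = (8 : ℝ) ^ (2 / 3 : ℝ) := by
            rw [show (8 : ℝ) = 2 ^ (3 : ℝ) by norm_num, ← Real.rpow_mul (by norm_num)]; norm_num
        _ ≤ (m : ℝ) ^ (2 / 3 : ℝ) := Real.rpow_le_rpow (by norm_num) (by linarith) (by norm_num)
    have : (4 : ℝ) * w ≤ m := by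
      calc (4 : ℝ) * w ≤ (m : ℝ) ^ (2 / 3 : ℝ) * (m : ℝ) ^ (1 / 3 : ℝ) :=
            mul_le_mul h23 h13 (by positivity) (by positivity)
        _ = m := by rw [← Real.rpow_add hm0]; norm_num
    exact_mod_cast this
  -- `q ≤ 1/4`
  have hq : 9216 * c₀ * (w : ℝ) ^ 3 * Real.log m ^ 2 / m ≤ 1 / 4 := by
    rw [div_le_iff₀ hm0]
    have h3a : (m : ℝ) ^ (3 * a) * (m : ℝ) ^ (3 * δ₀ / 2) = m := by
      rw [← Real.rpow_add hm0, hadef]; ring_nf; exact Real.rpow_one _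
    have hlog0 : 0 ≤ Real.log m ^ 2 := sq_nonneg _
    calc 9216 * c₀ * (w : ℝ) ^ 3 * Real.log m ^ 2 = (9216 * c₀ * Real.log m ^ 2) * (w : ℝ) ^ 3 := by ring
      _ ≤ (1 / 4 * (m : ℝ) ^ (3 * δ₀ / 2)) * (m : ℝ) ^ (3 * a) :=
          mul_le_mul hE4 hw3 (by positivity) (by positivity)
      _ = 1 / 4 * m := by rw [mul_assoc, mul_comm ((m : ℝ) ^ _), h3a]
  -- the dichotomy at `c = 2w`, `ε = m^{-5w}`
  set ε : ℝ := 1 / (m : ℝ) ^ (5 * w) with hεdef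
  have hε0 : 0 < ε := by positivity
  have hε1 : ε ≤ 1 / 2 := by
    rw [hεdef, div_le_div_iff₀ (by positivity) (by norm_num), one_mul]
    calc (2 : ℝ) ≤ m := by linarith
      _ = (m : ℝ) ^ 1 := (pow_one _).symm
      _ ≤ (m : ℝ) ^ (5 * w) := pow_le_pow_right₀ hm1r (by omega)
      _ = 1 * (m : ℝ) ^ (5 * w) := (one_mul _).symm
  have hdich := gapPM_dichotomy (m := m) hSF hc0.le hCD hDM hm1 hK (by omega : 2 ≤ 2 * w) hε0 hε1
    C hC hacc hrej
  obtain ⟨hS, hP⟩ := posSmall_posLost_le hc0.le hw1 h4w hq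
  have hN := negGain_le (m := m) hw1 hm16
  -- either branch gives `2^w ≤ size`
  have hsize : (2 : ℝ) ^ w ≤ C.size := by
    have h2w : (0 : ℝ) < 2 ^ w := by positivity
    rcases hdich with h | h
    · -- `1/2 ≤ size · δN ≤ size · 2^{-(w+1)}`
      have h1 : (1 : ℝ) / 2 ≤ C.size * (1 / 2 ^ (w + 1)) :=
        h.trans (mul_le_mul_of_nonneg_left hN (Nat.cast_nonneg _))
      rw [pow_succ] at h1
      have := mul_le_mul_of_nonneg_right h1 (by positivity : (0 : ℝ) ≤ 2 ^ w * 2)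
      field_simp at this
      nlinarith
    · -- `2/3 ≤ 1 - S ≤ size · δP ≤ size · (1/3) 4^{-w}`
      have h1 : (2 : ℝ) / 3 ≤ C.size * (1 / 3 * (1 / 4) ^ w) := by
        have := h.trans (mul_le_mul_of_nonneg_left hP (Nat.cast_nonneg _))
        linarith
      have h4 : (1 / 4 : ℝ) ^ w * 4 ^ w = 1 := by rw [← mul_pow]; norm_num
      have h24 : (2 : ℝ) ^ w ≤ 4 ^ w := pow_le_pow_left₀ (by norm_num) (by norm_num) w
      have := mul_le_mul_of_nonneg_right h1 (by positivity : (0 : ℝ) ≤ 3 * 4 ^ w)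
      have h5 : C.size * (1 / 3 * (1 / 4 : ℝ) ^ w) * (3 * 4 ^ w) = C.size := by
        rw [show C.size * (1 / 3 * (1 / 4 : ℝ) ^ w) * (3 * 4 ^ w)
          = C.size * ((1 / 4 : ℝ) ^ w * 4 ^ w) by ring, h4, mul_one]
      rw [h5] at this
      nlinarith
  -- and `2^{m^{1/3-δ}} ≤ 2^w`
  refine le_trans ?_ hsize
  have hexp : (m : ℝ) ^ (1 / 3 - δ : ℝ) ≤ w := by
    -- `m^{1/3-δ} ≤ m^{1/3-δ₀} = m^{a - δ₀/2}` and `2 m^{a-δ₀/2} ≤ m^a < w + 1`, `m^{a-δ₀/2} ≥ 1`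
    have h1 : (m : ℝ) ^ (1 / 3 - δ : ℝ) ≤ (m : ℝ) ^ (a - δ₀ / 2) :=
      Real.rpow_le_rpow_of_exponent_le hm1r (by rw [hadef]; linarith)
    have h2 : 2 * (m : ℝ) ^ (a - δ₀ / 2) ≤ (m : ℝ) ^ a := by
      calc 2 * (m : ℝ) ^ (a - δ₀ / 2) ≤ (m : ℝ) ^ (δ₀ / 2) * (m : ℝ) ^ (a - δ₀ / 2) :=
            mul_le_mul_of_nonneg_right hE5 (by positivity)
        _ = (m : ℝ) ^ a := by rw [← Real.rpow_add hm0]; ring_nf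
    have h3 : (1 : ℝ) ≤ (m : ℝ) ^ (a - δ₀ / 2) := Real.one_le_rpow hm1r (by rw [hadef]; linarith)
    linarith
  calc (2 : ℝ) ^ ((m : ℝ) ^ (1 / 3 - δ : ℝ)) ≤ (2 : ℝ) ^ (w : ℝ) :=
        Real.rpow_le_rpow_of_exponent_le one_le_two hexp
    _ = (2 : ℝ) ^ w := Real.rpow_natCast 2 w

end Summit.PneNP.PneNP.Theorems.NegLimitedGapPM
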